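import Literature.Analysis.FluidPDE.PassiveVectorTensorGalerkinSmoothSolution
import Literature.Analysis.FluidPDE.PassiveVectorTensorGalerkinSmoothEnstrophy
import Literature.Analysis.FluidPDE.PassiveVectorTensorPropagatorEnergyEquality
import Literature.Analysis.FluidPDE.PassiveVectorTensorPropagatorUnique
import Literature.Analysis.FluidPDE.PassiveVectorTensorEnergyDecay
import HarnessLib

/-!
# Loss-rate monotonicity of the passive-vector propagator with a smooth carrier

Analysis/FluidPDE proof-support file (theorems only; no named facts). For the solution propagator
`Torus.IsPropagator T b 𝔹 U` of Frisch's tensor passive-vector equation `∂ₜw + (b·∇)w + ∇π = 𝓛_𝔹 w`, `∇·w = 0`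
(constant tensor with Legendre–Hadamard constants `NearIso 𝔹 lo hi`, `0 < lo`) along a SMOOTH carrier
(`Torus.SmoothCarrier b M G`: jointly continuous, smooth divergence-free slices, `‖b‖ ≤ M`, `|∂b| ≤ G`), the energy
`E(t) = ‖U s t x‖²` loses, on a later window `[r, t]`, at most a controlled multiple of what it lost on `[s, r]`:

  `‖U s r x‖² − ‖U r t (U s r x)‖² ≤ (|hi|/lo) · e^{2 · #d · G · (t − s)} · ((t − r)/(r − s)) · (‖x‖² − ‖U s r x‖²)`

(`IsPropagator.loss_later_le`, all `0 ≤ s < r ≤ t ≤ T`, all `x ∈ L²`; window form `IsPropagator.loss_window_le` with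
`s = t₁`, `r = t₁ + R`, `t = s' ∈ [t₁ + R, t₁ + 2R]`, constant `(|hi|/lo)·e^{4#dGR}`). This is the parabolic smoothing estimate
"the dissipation rate is quasi-monotone" (Temam 1984, Ch. III §2 (enstrophy Gronwall); Constantin–Foias 1988, Ch. 10)
proved on GENUINE Fourier–Galerkin approximants (`PassiveVectorTensorGalerkinSmoothEnstrophy.pvsEnergy_loss_later_le`:
`D(τ₂) ≤ (|hi|/lo)e^{2#dG(τ₂−τ₁)}D(τ₁)` from the enstrophy Gronwall inequality and the sandwich `lo·Z ≤ D ≤ |hi|·Z`)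
and passed to the limit:

* §1 the Galerkin limit `w` of `PassiveVectorTensorGalerkinSmoothSolution` is the weak solution from the datum, so it obeys
  the energy equality with the truncated symbol forms (`IsWeakTensorPassiveVectorOn.ae_tendsto_setIntegral_symbForm`);
  every truncated symbol form of the approximants is below their dissipation rate and converges (finitely many modes,
  dominated convergence in time), and finite mode energies converge — whence, for a.e. pair of times, the loss inequality
  for `∫‖w ·‖²` (`PVSSetup.IsGalerkinLimit.ae_loss_later_le`);
* §2 the propagator side: restriction of a propagator to a shorter horizon (`IsPropagator.of_horizon_le`), continuity of
  `t ↦ ‖U s t y‖²` on `[s, T)` (`IsPropagator.continuousOn_norm_sq`, from the energy equality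
  `IsPropagator.exists_norm_sq_eq`), the representation `w τ = U s (s+τ) y` a.e. (`IsPropagator.repr`), the a.e. → everywhere
  upgrade by continuity, the σ-projection for general data, and the endpoint `t = T` through a propagator on a longer
  horizon (`exists_isPropagator`, uniqueness `IsPropagator.eq_of_isPropagator`).

Consumer: the (N2) conjunct of `cellInputs_alphaBeta_text` (K1L_D `stmt-AnomalousDissipation-27980`, registered stub
`stub_Z7_alphaBeta`, cell `ad-ideate`), with `b = b_{≤m}`, `𝔹 = k̄_m • renormStep …`, `s = jR`, `r = (j+1)R`, `t = s'`.

## References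

* R. Temam, *Navier–Stokes Equations*, 3rd ed. (North-Holland 1984), Ch. III §1 Lemma 1.2, Thm. 1.1; §2 (3.41)–(3.47). [`Temam1984`]
* P. Constantin, C. Foias, *Navier–Stokes Equations* (Chicago UP 1988), Ch. 8 (8.3)–(8.9), Ch. 10. [`ConstantinFoias1988`]
* J. C. Robinson, J. L. Rodrigo, W. Sadowski, *The three-dimensional Navier–Stokes equations* (CUP 2016), Thm. 4.4, Thm. 4.6. [`RobinsonRodrigoSadowski2016`]
* J.-L. Lions, E. Magenes, *Non-homogeneous boundary value problems* I (1972), Chap. 3 Thm. 1.1, §4.4. [`LionsMagenes1972`]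
* A. Pazy, *Semigroups of Linear Operators* (1983), Ch. 5 §5.1 Thm. 5.3. [`Pazy1983`]
* U. Frisch, *Turbulence* (CUP 1995), §9.6.3 eq. (9.57). [`Frisch1995Turbulence`]
-/

open MeasureTheory Set Filter Topology UnitAddTorus Metric Function
open scoped ENNReal NNReal InnerProductSpace

noncomputable section

namespace Literature.Analysis.FluidPDE

namespace Torus

open FunctionSpaces.Torus FunctionSpaces

variable {d : Type*} [Fintype d] [DecidableEq d]

/-! ## §0 Truncated symbol forms: continuity, bounds, convergence -/

section SymbForm

variable {𝔸 : Visc4 d}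

/-- Continuity in time of a truncated symbol form along continuous modes. [cite: Frisch1995Turbulence, §9.6.3 eq. (9.57) p. 233] -/
private theorem continuousOn_symbForm (𝔸 : Visc4 d) (K : ℕ) {γ : ℝ → (d → ℤ) → EuclideanSpace ℂ d} {s : Set ℝ}
    (hγ : ∀ k, ContinuousOn (fun τ => γ τ k) s) :
    ContinuousOn (fun τ => 4 * Real.pi ^ 2 * ∑ k ∈ freqBall K, (⟪γ τ k, symbT 𝔸 k (γ τ k)⟫_ℂ).re) s := by
  refine continuousOn_const.mul (continuousOn_finsetSum _ fun k _ => ?_)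
  have hT : ContinuousOn (fun τ => symbT 𝔸 k (γ τ k)) s :=
    ((symbTL 𝔸 (k : d → ℤ)).continuous.comp_continuousOn (hγ k)).congr fun _ _ => rfl
  exact Complex.continuous_re.comp_continuousOn ((hγ k).inner hT)

/-- Bound of a truncated symbol form by the mode energies. [cite: Frisch1995Turbulence, §9.6.3 eq. (9.57) p. 233] -/
private theorem abs_symbForm_le (𝔸 : Visc4 d) (K : ℕ) {γ : (d → ℤ) → EuclideanSpace ℂ d} {E₀ : ℝ}
    (hγ : ∀ k, ‖γ k‖ ^ 2 ≤ E₀) :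
    |4 * Real.pi ^ 2 * ∑ k ∈ freqBall K, (⟪γ k, symbT 𝔸 k (γ k)⟫_ℂ).re| ≤
      4 * Real.pi ^ 2 * (∑ k ∈ freqBall K, ‖symbTL 𝔸 k‖) * E₀ := by
  have h4 : (0:ℝ) ≤ 4 * Real.pi ^ 2 := by positivity
  calc |4 * Real.pi ^ 2 * ∑ k ∈ freqBall K, (⟪γ k, symbT 𝔸 k (γ k)⟫_ℂ).re|
      = 4 * Real.pi ^ 2 * |∑ k ∈ freqBall K, (⟪γ k, symbT 𝔸 k (γ k)⟫_ℂ).re| := by rw [abs_mul, abs_of_nonneg h4]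
    _ ≤ 4 * Real.pi ^ 2 * ((∑ k ∈ freqBall K, ‖symbTL 𝔸 k‖) * E₀) := by
        refine mul_le_mul_of_nonneg_left ?_ h4
        rw [Finset.sum_mul]
        refine (Finset.abs_sum_le_sum_abs _ _).trans (Finset.sum_le_sum fun k _ => ?_)
        calc |(⟪γ k, symbT 𝔸 k (γ k)⟫_ℂ).re| ≤ ‖⟪γ k, symbT 𝔸 k (γ k)⟫_ℂ‖ := Complex.abs_re_le_norm _
          _ ≤ ‖γ k‖ * ‖symbT 𝔸 k (γ k)‖ := norm_inner_le_norm _ _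
          _ ≤ ‖γ k‖ * (‖symbTL 𝔸 k‖ * ‖γ k‖) :=
              mul_le_mul_of_nonneg_left (norm_symbT_le_opNorm 𝔸 k _) (norm_nonneg _)
          _ = ‖symbTL 𝔸 k‖ * ‖γ k‖ ^ 2 := by ring
          _ ≤ ‖symbTL 𝔸 k‖ * E₀ := mul_le_mul_of_nonneg_left (hγ k) (norm_nonneg _)
    _ = 4 * Real.pi ^ 2 * (∑ k ∈ freqBall K, ‖symbTL 𝔸 k‖) * E₀ := by ring

/-- Modewise convergence passes to a truncated symbol form. [cite: Frisch1995Turbulence, §9.6.3 eq. (9.57) p. 233] -/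
private theorem tendsto_symbForm (𝔸 : Visc4 d) (K : ℕ) {γ : ℕ → (d → ℤ) → EuclideanSpace ℂ d}
    {γ' : (d → ℤ) → EuclideanSpace ℂ d} (hγ : ∀ k, Tendsto (fun n => γ n k) atTop (𝓝 (γ' k))) :
    Tendsto (fun n => 4 * Real.pi ^ 2 * ∑ k ∈ freqBall K, (⟪γ n k, symbT 𝔸 k (γ n k)⟫_ℂ).re) atTop
      (𝓝 (4 * Real.pi ^ 2 * ∑ k ∈ freqBall K, (⟪γ' k, symbT 𝔸 k (γ' k)⟫_ℂ).re)) := by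
  refine tendsto_const_nhds.mul (tendsto_finsetSum _ fun k _ => ?_)
  have hT : Tendsto (fun n => symbT 𝔸 k (γ n k)) atTop (𝓝 (symbT 𝔸 k (γ' k))) := by
    have := ((symbTL 𝔸 (k : d → ℤ)).continuous.tendsto _).comp (hγ k)
    simpa only [Function.comp_def, symbTL_apply] using this
  exact (Complex.continuous_re.tendsto _).comp ((hγ k).inner hT)

end SymbForm

/-! ## §1 The Galerkin side: the loss inequality survives the limit (a.e. pair of times) -/

section Galerkin

variable {𝔸 : Visc4 d} {lo hi : ℝ} {b : ℝ → UnitAddTorus d → EuclideanSpace ℝ d} {M G : ℝ}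
  {w₀ : UnitAddTorus d → EuclideanSpace ℝ d}
  {h : PVSSetup 𝔸 lo hi b M G w₀} {φ : ℕ → ℕ} {c : ℝ → (d → ℤ) → EuclideanSpace ℂ d}
  {w : ℝ → UnitAddTorus d → EuclideanSpace ℝ d}

/-- **Every truncated symbol form of a Galerkin approximant is below its loss**: for `0 ≤ ρ ≤ θ` and every `K`,
`2 ∫_{(ρ,θ]} 4π² Σ_{|k|≤K} Re⟪α̂_N(τ)(k), T_𝔸(k) α̂_N(τ)(k)⟫ dτ ≤ E_N(ρ) − E_N(θ)` (energy identity
`E_N(θ) = E_N(ρ) − 2∫D_N` and `Q_K ≤ D_N` termwise on transversal states). [cite: RobinsonRodrigoSadowski2016, Thm. 4.4 Step 2 (4.6)–(4.8)] -/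
theorem PVSSetup.two_mul_setIntegral_symbForm_le (h : PVSSetup 𝔸 lo hi b M G w₀) (N K : ℕ) {ρ θ : ℝ}
    (hρ : 0 ≤ ρ) (hρθ : ρ ≤ θ) :
    2 * ∫ τ in Ioc ρ θ, 4 * Real.pi ^ 2 * ∑ k ∈ freqBall K,
        (⟪h.galerkinCoeffAt N τ k, symbT 𝔸 k (h.galerkinCoeffAt N τ k)⟫_ℂ).re ≤
      pvsEnergy (freqBall N) (h.galerkinCoeff N ρ) - pvsEnergy (freqBall N) (h.galerkinCoeff N θ) := by
  obtain ⟨-, hmem, hcont, hsol, -⟩ := h.galerkinCoeff_spec N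
  have hb := h.carrier
  have hid := pvsEnergy_eq_sub_integral 𝔸 (neg_mem_freqBall_of_mem (N := N)) (fun t => hb.smooth t)
    (fun t => hb.divFree t) (hsol θ) (fun t _ => hmem t) (hcont.mono Icc_subset_Ici_self) hρ hρθ le_rfl
  rw [intervalIntegral.integral_of_le hρθ] at hid
  -- `∫ Q_K(α̂_N) ≤ ∫ D_N` on `(ρ, θ]`
  have hQc : ContinuousOn (fun τ => 4 * Real.pi ^ 2 * ∑ k ∈ freqBall K,
      (⟪h.galerkinCoeffAt N τ k, symbT 𝔸 k (h.galerkinCoeffAt N τ k)⟫_ℂ).re) (Icc ρ θ) :=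
    continuousOn_symbForm 𝔸 K fun k => (h.continuousOn_galerkinCoeffAt N k).mono
      (Icc_subset_Ici_self.trans (Ici_subset_Ici.2 hρ))
  have hDc : ContinuousOn (fun τ => pvsDiss (freqBall N) 𝔸 (h.galerkinCoeff N τ)) (Icc ρ θ) :=
    continuousOn_pvsDiss_comp 𝔸 (hcont.mono (Icc_subset_Ici_self.trans (Ici_subset_Ici.2 hρ)))
  have hle : ∫ τ in Ioc ρ θ, 4 * Real.pi ^ 2 * ∑ k ∈ freqBall K,
      (⟪h.galerkinCoeffAt N τ k, symbT 𝔸 k (h.galerkinCoeffAt N τ k)⟫_ℂ).re ≤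
      ∫ τ in Ioc ρ θ, pvsDiss (freqBall N) 𝔸 (h.galerkinCoeff N τ) := by
    refine setIntegral_mono_on (hQc.integrableOn_Icc.mono_set Ioc_subset_Icc_self)
      (hDc.integrableOn_Icc.mono_set Ioc_subset_Icc_self) measurableSet_Ioc fun τ _ => ?_
    exact sum_re_inner_symbT_le_pvsDiss h.nearIso h.lo_nonneg (hmem τ).2 (freqBall K)
  linarith

/-- **Convergence of the truncated symbol forms of the approximants** along a Galerkin limit, integrated over
`(ρ, θ]` with `0 ≤ ρ ≤ θ` (finitely many modes, each converging for every `τ ≥ 0`, uniformly bounded by the energy;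
dominated convergence in time). [cite: RobinsonRodrigoSadowski2016, Thm. 4.4 Step 4] -/
theorem PVSSetup.IsGalerkinLimit.tendsto_setIntegral_symbForm_approx (hl : h.IsGalerkinLimit φ c w) (K : ℕ)
    {ρ θ : ℝ} (hρ : 0 ≤ ρ) :
    Tendsto (fun n => ∫ τ in Ioc ρ θ, 4 * Real.pi ^ 2 * ∑ k ∈ freqBall K,
        (⟪h.galerkinCoeffAt (φ n) τ k, symbT 𝔸 k (h.galerkinCoeffAt (φ n) τ k)⟫_ℂ).re) atTop
      (𝓝 (∫ τ in Ioc ρ θ, 4 * Real.pi ^ 2 * ∑ k ∈ freqBall K, (⟪c τ k, symbT 𝔸 k (c τ k)⟫_ℂ).re)) := by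
  set E₀ : ℝ := ∫ x, ‖w₀ x‖ ^ 2 with hE₀
  have hE0 : 0 ≤ E₀ := integral_nonneg fun x => by positivity
  set B : ℝ := 4 * Real.pi ^ 2 * (∑ k ∈ freqBall K, ‖symbTL 𝔸 (k : d → ℤ)‖) * E₀ with hB
  have hIoc : Ioc ρ θ ⊆ Ici 0 := fun τ hτ => (hρ.trans hτ.1.le : 0 ≤ τ)
  refine tendsto_integral_filter_of_dominated_convergence (fun _ => B) ?_ ?_ ?_ ?_
  · exact Eventually.of_forall fun n =>
      ((continuousOn_symbForm 𝔸 K fun k => h.continuousOn_galerkinCoeffAt (φ n) k).mono hIoc).aestronglyMeasurable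
        measurableSet_Ioc
  · refine Eventually.of_forall fun n => ?_
    rw [ae_restrict_iff' measurableSet_Ioc]
    refine ae_of_all _ fun τ hτ => ?_
    rw [Real.norm_eq_abs]
    refine abs_symbForm_le 𝔸 K fun k => ?_
    have h1 := h.norm_galerkinCoeffAt_le (φ n) (hIoc hτ) k
    calc ‖h.galerkinCoeffAt (φ n) τ k‖ ^ 2 ≤ Real.sqrt E₀ ^ 2 := pow_le_pow_left₀ (norm_nonneg _) h1 2
      _ = E₀ := Real.sq_sqrt hE0
  · exact integrableOn_const measure_Ioc_lt_top.ne
  · rw [ae_restrict_iff' measurableSet_Ioc]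
    exact ae_of_all _ fun τ hτ => tendsto_symbForm 𝔸 K fun k => hl.tendsto_coeff τ (hIoc hτ) k

/-- **The loss inequality survives the Galerkin limit, against truncated symbol forms**: for `0 < lo`, `0 < ρ ≤ θ`
and every `K`, with `L = (|hi|/lo)·e^{2#dGθ}·(θ−ρ)/ρ`,
`2 ∫_{(ρ,θ]} 4π² Σ_{|k|≤K} Re⟪c(τ)(k), T_𝔸(k) c(τ)(k)⟫ dτ + L·∫‖w(ρ)‖² ≤ L·∫‖w₀‖²`
(Galerkin-level inequality `pvsEnergy_loss_later_le`, `E_N(0) ≤ ∫‖w₀‖²`, the truncated forms below the loss,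
finite mode energies below the energy; limits by `tendsto_setIntegral_symbForm_approx`, modewise convergence and
Parseval `∫‖w ρ‖² = Σ_k ‖c ρ k‖²`). [cite: Temam1984, Ch. III §2 (3.41)–(3.47)] -/
theorem PVSSetup.IsGalerkinLimit.symbForm_loss_le (hl : h.IsGalerkinLimit φ c w) (hlo : 0 < lo) {ρ θ : ℝ}
    (hρ : 0 < ρ) (hρθ : ρ ≤ θ) (K : ℕ) :
    2 * (∫ τ in Ioc ρ θ, 4 * Real.pi ^ 2 * ∑ k ∈ freqBall K, (⟪c τ k, symbT 𝔸 k (c τ k)⟫_ℂ).re) +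
        (|hi| / lo * Real.exp (2 * ((Fintype.card d : ℝ) * G) * θ)) * ((θ - ρ) / ρ) * ∫ x, ‖w ρ x‖ ^ 2 ≤
      (|hi| / lo * Real.exp (2 * ((Fintype.card d : ℝ) * G) * θ)) * ((θ - ρ) / ρ) * ∫ x, ‖w₀ x‖ ^ 2 := by
  set L : ℝ := (|hi| / lo * Real.exp (2 * ((Fintype.card d : ℝ) * G) * θ)) * ((θ - ρ) / ρ) with hL
  set E₀ : ℝ := ∫ x, ‖w₀ x‖ ^ 2 with hE₀
  have hL0 : 0 ≤ L := by
    have : 0 ≤ θ - ρ := sub_nonneg.2 hρθ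
    positivity
  set I : ℕ → ℝ := fun n => ∫ τ in Ioc ρ θ, 4 * Real.pi ^ 2 * ∑ k ∈ freqBall K,
    (⟪h.galerkinCoeffAt (φ n) τ k, symbT 𝔸 k (h.galerkinCoeffAt (φ n) τ k)⟫_ℂ).re with hI
  -- the inequality at the Galerkin level, for every `n` and every finite set of modes `F`
  have hstep : ∀ (F : Finset (d → ℤ)) (n : ℕ),
      2 * I n + L * ∑ k ∈ F, ‖h.galerkinCoeffAt (φ n) ρ k‖ ^ 2 ≤ L * E₀ := by
    intro F n
    obtain ⟨-, hmem, hcont, hsol, -⟩ := h.galerkinCoeff_spec (φ n)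
    have hGal := pvsEnergy_loss_later_le h.nearIso hlo (neg_mem_freqBall_of_mem (N := φ n)) h.carrier (hsol θ)
      (fun t _ => hmem t) (hcont.mono Icc_subset_Ici_self) hρ hρθ le_rfl
    have h0 : pvsEnergy (freqBall (φ n)) (h.galerkinCoeff (φ n) 0) ≤ E₀ := h.sum_norm_sq_galerkinCoeff_le (φ n) le_rfl
    have hF : ∑ k ∈ F, ‖h.galerkinCoeffAt (φ n) ρ k‖ ^ 2 ≤ pvsEnergy (freqBall (φ n)) (h.galerkinCoeff (φ n) ρ) :=
      h.sum_norm_sq_galerkinCoeffAt_le_sum (φ n) ρ F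
    have hQ := h.two_mul_setIntegral_symbForm_le (φ n) K hρ.le hρθ
    have h1 : L * (pvsEnergy (freqBall (φ n)) (h.galerkinCoeff (φ n) 0) -
        pvsEnergy (freqBall (φ n)) (h.galerkinCoeff (φ n) ρ)) ≤
        L * (E₀ - pvsEnergy (freqBall (φ n)) (h.galerkinCoeff (φ n) ρ)) :=
      mul_le_mul_of_nonneg_left (by linarith) hL0
    have h2 := mul_le_mul_of_nonneg_left hF hL0
    rw [← hL] at hGal
    linarith
  -- pass to the limit `n → ∞` for each `F`
  have hlimF : ∀ F : Finset (d → ℤ),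
      2 * (∫ τ in Ioc ρ θ, 4 * Real.pi ^ 2 * ∑ k ∈ freqBall K, (⟪c τ k, symbT 𝔸 k (c τ k)⟫_ℂ).re) +
        L * ∑ k ∈ F, ‖c ρ k‖ ^ 2 ≤ L * E₀ := by
    intro F
    have hT1 : Tendsto (fun n => 2 * I n) atTop
        (𝓝 (2 * ∫ τ in Ioc ρ θ, 4 * Real.pi ^ 2 * ∑ k ∈ freqBall K, (⟪c τ k, symbT 𝔸 k (c τ k)⟫_ℂ).re)) :=
      (hl.tendsto_setIntegral_symbForm_approx K hρ.le).const_mul 2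
    have hT2 : Tendsto (fun n => L * ∑ k ∈ F, ‖h.galerkinCoeffAt (φ n) ρ k‖ ^ 2) atTop
        (𝓝 (L * ∑ k ∈ F, ‖c ρ k‖ ^ 2)) :=
      (tendsto_finsetSum _ fun k _ => ((hl.tendsto_coeff ρ hρ.le k).norm).pow 2).const_mul L
    exact le_of_tendsto' (hT1.add hT2) fun n => hstep F n
  -- sup over `F` by Parseval for the limit
  have hsum := (hl.hasSum_sq_norm hρ.le).mul_left L
  have key : L * ∫ x, ‖w ρ x‖ ^ 2 ≤ L * E₀ -
      2 * (∫ τ in Ioc ρ θ, 4 * Real.pi ^ 2 * ∑ k ∈ freqBall K, (⟪c τ k, symbT 𝔸 k (c τ k)⟫_ℂ).re) :=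
    hasSum_le_of_sum_le hsum fun F => by
      rw [← Finset.mul_sum]
      have := hlimF F
      linarith
  linarith

/-- **The loss inequality for the Galerkin limit, a.e. pair of times.** For `0 < lo` and `0 < T`: for a.e. `ρ ∈ (0,T)` and
a.e. `θ ∈ (0,T)` with `ρ ≤ θ`, writing `W(τ) = ∫‖w τ‖²` and `L = (|hi|/lo)·e^{2#dGθ}·(θ−ρ)/ρ`,
`(W(ρ) − W(θ)) + L·W(ρ) ≤ L·∫‖w₀‖²`. The limit is the weak solution from `w₀` (`IsGalerkinLimit.isWeakTensorPassiveVectorOn`),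
so `2·lim_K ∫_{(0,t]} Q_K = ∫‖w₀‖² − W(t)` for a.e. `t` (`IsWeakTensorPassiveVectorOn.ae_tendsto_setIntegral_symbForm`); combine
with `symbForm_loss_le`. [cite: Temam1984, Ch. III §1 Lemma 1.2, §2 (3.41)–(3.47)] -/
theorem PVSSetup.IsGalerkinLimit.ae_loss_later_le (hl : h.IsGalerkinLimit φ c w) (hlo : 0 < lo) {T : ℝ} (hT : 0 < T) :
    ∀ᵐ ρ ∂(volume.restrict (Ioo 0 T)), ∀ᵐ θ ∂(volume.restrict (Ioo 0 T)), ρ ≤ θ →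
      ((∫ x, ‖w ρ x‖ ^ 2) - ∫ x, ‖w θ x‖ ^ 2) +
          (|hi| / lo * Real.exp (2 * ((Fintype.card d : ℝ) * G) * θ)) * ((θ - ρ) / ρ) * ∫ x, ‖w ρ x‖ ^ 2 ≤
        (|hi| / lo * Real.exp (2 * ((Fintype.card d : ℝ) * G) * θ)) * ((θ - ρ) / ρ) * ∫ x, ‖w₀ x‖ ^ 2 := by
  have hsol := hl.isWeakTensorPassiveVectorOn hT
  have h𝔸T : NearIso (majorTranspose 𝔸) lo hi := (nearIso_majorTranspose_iff 𝔸 lo hi).2 h.nearIso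
  have hlim := hsol.ae_tendsto_setIntegral_symbForm h𝔸T hlo h.memLp h.divFree (h.carrier.memLp_top_stLift T)
  set Q : ℕ → ℝ → ℝ := fun N s => 4 * Real.pi ^ 2 * ∑ k ∈ freqBall N, (⟪c s k, symbT 𝔸 k (c s k)⟫_ℂ).re with hQ
  set E₀ : ℝ := ∫ x, ‖w₀ x‖ ^ 2 with hE₀
  -- the truncated forms of the weak solution are those of the limiting modes
  have hcongr : ∀ (t : ℝ) (N : ℕ), (∫ s in Ioc 0 t, 4 * Real.pi ^ 2 * ∑ k ∈ FunctionSpaces.Torus.freqBall N,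
      (⟪mFourierCoeff (FunctionSpaces.EuclideanSpace.complexify ∘ w s) k,
        symbT (majorTranspose 𝔸) k (mFourierCoeff (FunctionSpaces.EuclideanSpace.complexify ∘ w s) k)⟫_ℂ).re) =
      ∫ s in Ioc 0 t, Q N s := by
    intro t N
    refine setIntegral_congr_fun measurableSet_Ioc fun s hs => ?_
    simp only [hQ]
    congr 1
    exact Finset.sum_congr rfl fun k _ => by rw [hl.coeff_eq s hs.1.le k, re_inner_symbT_majorTranspose_self]
  have hlim' : ∀ᵐ t ∂(volume.restrict (Ioo 0 T)),
      Tendsto (fun N => ∫ s in Ioc 0 t, Q N s) atTop (𝓝 ((E₀ - ∫ x, ‖w t x‖ ^ 2) / 2)) :=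
    hlim.mono fun t ht => ht.congr fun N => hcongr t N
  -- integrability of the truncated forms of the limit on bounded intervals
  have hQc : ∀ N, ContinuousOn (Q N) (Ici 0) := fun N => continuousOn_symbForm 𝔸 N fun k => hl.continuousOn_coeff k
  have hQi : ∀ N (a t : ℝ), 0 ≤ a → IntegrableOn (Q N) (Ioc a t) volume := fun N a t ha =>
    ((hQc N).mono (Icc_subset_Ici_self.trans (Ici_subset_Ici.2 ha))).integrableOn_Icc.mono_set Ioc_subset_Icc_self
  filter_upwards [hlim', ae_restrict_mem measurableSet_Ioo] with ρ hρl hρI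
  filter_upwards [hlim', ae_restrict_mem measurableSet_Ioo] with θ hθl hθI
  intro hρθ
  set L : ℝ := (|hi| / lo * Real.exp (2 * ((Fintype.card d : ℝ) * G) * θ)) * ((θ - ρ) / ρ) with hL
  -- `∫_{(ρ,θ]} Q_N = ∫_{(0,θ]} Q_N − ∫_{(0,ρ]} Q_N`
  have hsplit : ∀ N, ∫ s in Ioc ρ θ, Q N s = (∫ s in Ioc 0 θ, Q N s) - ∫ s in Ioc 0 ρ, Q N s := by
    intro N
    rw [← Ioc_union_Ioc_eq_Ioc hρI.1.le hρθ, setIntegral_union (Ioc_disjoint_Ioc_of_le le_rfl) measurableSet_Ioc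
      (hQi N 0 ρ le_rfl) (hQi N ρ θ hρI.1.le)]
    ring
  have hT3 : Tendsto (fun N => (2 * ∫ s in Ioc ρ θ, Q N s) + L * ∫ x, ‖w ρ x‖ ^ 2) atTop
      (𝓝 (2 * ((E₀ - ∫ x, ‖w θ x‖ ^ 2) / 2 - (E₀ - ∫ x, ‖w ρ x‖ ^ 2) / 2) + L * ∫ x, ‖w ρ x‖ ^ 2)) := by
    have h1 := ((hθl.sub hρl).const_mul 2).add_const (L * ∫ x, ‖w ρ x‖ ^ 2)
    exact h1.congr fun N => by rw [hsplit N]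
  have hbound : ∀ N, (2 * ∫ s in Ioc ρ θ, Q N s) + L * ∫ x, ‖w ρ x‖ ^ 2 ≤ L * E₀ := fun N =>
    hl.symbForm_loss_le hlo hρI.1 hρθ N
  have := le_of_tendsto' hT3 hbound
  linarith

end Galerkin

/-! ## §2 The propagator side -/

section Propagator

variable {T : ℝ} {𝔸 : Visc4 d} {lo hi : ℝ} {b : ℝ → UnitAddTorus d → EuclideanSpace ℝ d}
  {U : ℝ → ℝ → (Lp (EuclideanSpace ℝ d) 2 (volume : Measure (UnitAddTorus d)) →L[ℝ]
    Lp (EuclideanSpace ℝ d) 2 (volume : Measure (UnitAddTorus d)))}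

omit [Fintype d] [DecidableEq d] in
/-- The convective derivative of the zero field vanishes. [folklore] -/
private theorem convect_zero_right₀ {F : Type*} [NormedAddCommGroup F] [NormedSpace ℝ F]
    (u : UnitAddTorus d → EuclideanSpace ℝ d) (x : UnitAddTorus d) :
    FunctionSpaces.Torus.convect u (0 : UnitAddTorus d → F) x = 0 := by
  unfold FunctionSpaces.Torus.convect FunctionSpaces.Torus.fderiv FunctionSpaces.Torus.liftAt
  simp

/-- Time shortening of a weak solution (`A = 0`): a weak solution on `[0, T)` is one on `[0, T')` for `T' ≤ T`
(a `T'`-test is a `T`-test and the weak-form integrand vanishes on `[T', T)`).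
-- adapted from `IsWeakTensorPassiveVectorOn.of_le` (Summits-side file `…LagrangianStepEulerianSubwindowRepr`), not importable here
[cite: DiPernaLions1989, §II.1 (12)–(14)] -/
private theorem weakSol_shorten {T T' : ℝ} {𝔸 : Visc4 d} {b w : ℝ → UnitAddTorus d → EuclideanSpace ℝ d}
    {w₀ : UnitAddTorus d → EuclideanSpace ℝ d}
    (h : IsWeakTensorPassiveVectorOn 0 T 𝔸 b w₀ w) (hT' : T' ≤ T) : IsWeakTensorPassiveVectorOn 0 T' 𝔸 b w₀ w := by
  have hsub : Ioo (0:ℝ) T' ⊆ Ioo 0 T := Ioo_subset_Ioo le_rfl hT'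
  have hsubp : Ioo (0:ℝ) T' ×ˢ (univ : Set (EuclideanSpace ℝ d)) ⊆ Ioo 0 T ×ˢ univ := Set.prod_mono hsub le_rfl
  have hμ : volume.restrict (Ioo (0:ℝ) T' ×ˢ (univ : Set (EuclideanSpace ℝ d))) ≤ volume.restrict (Ioo 0 T ×ˢ univ) :=
    Measure.restrict_mono hsubp le_rfl
  have hν : volume.restrict (Ioo (0:ℝ) T') ≤ volume.restrict (Ioo 0 T) := Measure.restrict_mono hsub le_rfl
  obtain ⟨C, hC⟩ := h.ae_lintegral_sq_le
  refine ⟨h.aestronglyMeasurable.mono_measure hμ, h.aestronglyMeasurable_carrier.mono_measure hμ,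
    ⟨C, ae_restrict_of_ae_restrict_of_subset hsub hC⟩,
    lt_of_le_of_lt (lintegral_mono' hν le_rfl) h.lintegral_carrier_lt_top,
    lt_of_le_of_lt (lintegral_mono' hν le_rfl) h.lintegral_mul_lt_top,
    ae_restrict_of_ae_restrict_of_subset hsub h.ae_isWeaklyDivFree_carrier,
    ae_restrict_of_ae_restrict_of_subset hsub h.ae_isWeaklyDivFree, ?_⟩
  intro Ψ hΨ hΨdiv
  obtain ⟨hsm, T'', hT'', hzero⟩ := hΨ
  have hΨT : FunctionSpaces.Torus.IsSpaceTimeTest T Ψ := ⟨hsm, T'', hT''.trans_le hT', hzero⟩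
  have key := h.weak_eq Ψ hΨT hΨdiv
  set F : ℝ → ℝ := fun t => ∫ x, (⟪w t x, FunctionSpaces.Torus.timeDeriv Ψ t x +
      FunctionSpaces.Torus.convect (b t) (Ψ t) x + viscAdj 𝔸 (Ψ t) x⟫_ℝ +
        0 * ⟪b t x, FunctionSpaces.Torus.convect (w t) (Ψ t) x⟫_ℝ) with hF
  have hvan : ∀ t, T' ≤ t → F t = 0 := by
    intro t ht
    have hΨt : Ψ t = 0 := hzero t (hT''.le.trans ht)
    have hdt : ∀ x, FunctionSpaces.Torus.timeDeriv Ψ t x = 0 := by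
      intro x
      unfold FunctionSpaces.Torus.timeDeriv
      have hev : (fun τ => Ψ τ x) =ᶠ[𝓝 t] fun _ => (0 : EuclideanSpace ℝ d) := by
        have hmem : Ioi T'' ∈ 𝓝 t := Ioi_mem_nhds (hT''.trans_le ht)
        filter_upwards [hmem] with τ hτ
        rw [hzero τ (le_of_lt hτ)]; rfl
      rw [hev.deriv_eq, deriv_const]
    rw [hF]
    simp only [hdt, hΨt, convect_zero_right₀, viscAdj_zero_field, inner_zero_right, zero_mul, add_zero, integral_zero]
  have hI : ∫ t in Ioo 0 T, F t = ∫ t in Ioo 0 T', F t := by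
    have e1 : ∫ t in Ioo 0 T, F t = ∫ t in Ioo 0 T, (Ioo 0 T').indicator F t := by
      refine setIntegral_congr_fun measurableSet_Ioo fun t ht => ?_
      by_cases htT : t < T'
      · rw [Set.indicator_of_mem (show t ∈ Ioo 0 T' from ⟨ht.1, htT⟩) F]
      · rw [Set.indicator_of_notMem (show t ∉ Ioo 0 T' from fun h' => htT h'.2) F, hvan t (not_lt.1 htT)]
    rw [e1, setIntegral_indicator measurableSet_Ioo, Set.inter_eq_right.2 hsub]
  rw [← hI]
  exact key

/-- **Restriction of a propagator to a shorter horizon.** If `U` is the solution propagator on `[0, T₀]` (elliptic constant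
tensor, bounded a.e. divergence-free carrier) then it is the solution propagator on `[0, T]` for every `T ≤ T₀`: the
algebraic fields restrict trivially, and every weak solution on a shortened window `(0, T − s)` is represented by `U`
because the Lions solution on the full window `(0, T₀ − s)` is (`repr`), shortens to one on `(0, T − s)`, and weak solutions
there are unique (`IsWeakTensorPassiveVectorOn.ae_eq_of_memLp_top`).
[cite: Pazy1983, Ch. 5 §5.1 Thm. 5.3] [cite: LionsMagenes1972, Chap. 3 Thm. 1.1] -/
theorem IsPropagator.of_horizon_le {T₀ : ℝ} (hU : IsPropagator T₀ b 𝔸 U) (h𝔸 : NearIso 𝔸 lo hi) (hlo : 0 < lo)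
    (hb : MemLp (stLift b) ∞ (volume.restrict (Ioo 0 T₀ ×ˢ univ)))
    (hbdiv : ∀ᵐ t ∂(volume.restrict (Ioo 0 T₀)), FunctionSpaces.Torus.IsWeaklyDivFree (b t))
    (hT : T ≤ T₀) : IsPropagator T b 𝔸 U where
  norm_le := hU.norm_le
  comp := fun s t r hs hst htr hrT => hU.comp s t r hs hst htr (hrT.trans hT)
  self_of_divFree := fun s hs hsT => hU.self_of_divFree s hs (hsT.trans hT)
  divFree := hU.divFree
  eq_zero_of_orth := hU.eq_zero_of_orth
  continuousOn := fun s hs hsT y z => (hU.continuousOn s hs (hsT.trans hT) y z).mono (Icc_subset_Icc le_rfl hT)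
  repr := by
    intro s hs hsT φ hφ hφdiv w hw
    have hsT₀ : s < T₀ := hsT.trans_le hT
    obtain ⟨W, hW⟩ := exists_windowSol h𝔸 hlo hb hbdiv hs hsT₀ hφ hφdiv
    have hrep := hU.repr s hs hsT₀ φ hφ hφdiv W hW
    have hW' : IsWeakTensorPassiveVectorOn 0 (T - s) 𝔸 (fun τ => b (s + τ)) φ W :=
      weakSol_shorten hW (by linarith)
    have hb' : MemLp (stLift (fun τ => b (s + τ))) ∞ (volume.restrict (Ioo 0 (T - s) ×ˢ univ)) :=
      (memLp_top_stLift_shift_window hb hs).mono_measure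
        (Measure.restrict_mono (Set.prod_mono (Ioo_subset_Ioo le_rfl (by linarith)) le_rfl) le_rfl)
    have huniq := IsWeakTensorPassiveVectorOn.ae_eq_of_memLp_top h𝔸 hlo hw hW' hb'
    have hrep' : ∀ᵐ τ ∂(volume.restrict (Ioo 0 (T - s))),
        ∃ hτ : MemLp (W τ) 2 volume, hτ.toLp (W τ) = U s (s + τ) (hφ.toLp φ) :=
      ae_restrict_of_ae_restrict_of_subset (Ioo_subset_Ioo le_rfl (by linarith)) hrep
    filter_upwards [huniq, hrep'] with τ h1 h2
    obtain ⟨hm, he⟩ := h2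
    refine ⟨hm.ae_eq h1.symm, ?_⟩
    rw [← he]
    exact Lp.ext ((MemLp.coeFn_toLp _).trans (h1.trans (MemLp.coeFn_toLp hm).symm))

omit [DecidableEq d] in
/-- The dissipation of an `L²(μ_T)` gradient against a constant tensor is integrable in time.
-- adapted from the private `integrableOn_dissipation_const_E1` of `PassiveVectorTensorPropagatorEnergyEquality`
[cite: LionsMagenes1972, Chap. 3 §4.4] -/
private theorem integrableOn_dissipation₀ {T : ℝ} (𝔸 : Visc4 d) {G : ℝ → d → UnitAddTorus d → EuclideanSpace ℝ d}
    (hG2 : ∀ c, MemLp (uncurry (G · c)) 2 (((volume : Measure ℝ).restrict (Ioo 0 T)).prod volume)) :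
    IntegrableOn (fun τ => ∫ x, ∑ l, ∑ i, ∑ c, ∑ e, 𝔸 i c l e * (G τ c x) i * (G τ e x) l) (Ioo 0 T) := by
  have hH : Integrable (fun p : ℝ × UnitAddTorus d => ∑ l, ∑ i, ∑ c, ∑ e, 𝔸 i c l e * (G p.1 c p.2) i * (G p.1 e p.2) l)
      (((volume : Measure ℝ).restrict (Ioo 0 T)).prod volume) := by
    refine integrable_finsetSum _ fun l _ => integrable_finsetSum _ fun i _ =>
      integrable_finsetSum _ fun c _ => integrable_finsetSum _ fun e _ => ?_
    refine Integrable.mono' (((hG2 c).norm.integrable_mul (hG2 e).norm).const_mul |𝔸 i c l e|)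
      ((aestronglyMeasurable_const.mul
        ((PiLp.continuous_apply 2 _ i).comp_aestronglyMeasurable (hG2 c).1)).mul
        ((PiLp.continuous_apply 2 _ l).comp_aestronglyMeasurable (hG2 e).1)) (ae_of_all _ fun p => ?_)
    rw [Real.norm_eq_abs, abs_mul, abs_mul]
    show |𝔸 i c l e| * |(G p.1 c p.2) i| * |(G p.1 e p.2) l| ≤ |𝔸 i c l e| * (‖G p.1 c p.2‖ * ‖G p.1 e p.2‖)
    rw [mul_assoc]
    exact mul_le_mul_of_nonneg_left (mul_le_mul (FunctionSpaces.Torus.abs_apply_le_norm (G p.1 c p.2) i)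
      (FunctionSpaces.Torus.abs_apply_le_norm (G p.1 e p.2) l) (abs_nonneg _) (norm_nonneg _)) (abs_nonneg _)
  exact hH.integral_prod_left

/-- **The energy of the propagator is continuous on `[s, T)`**: `t ↦ ‖U s t y‖²` is continuous on `[s, T)` for a weakly
divergence-free `y ∈ L²` (it equals `‖y‖² − 2∫_{(0,t−s]} D` with an integrable dissipation `D`,
`IsPropagator.exists_norm_sq_eq`; Lions–Magenes `w ∈ C([0,T]; L²)`).
[cite: LionsMagenes1972, Chap. 3 §4.4 (4.20)] [cite: Temam1984, Ch. III §1 Lemma 1.2] -/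
theorem IsPropagator.continuousOn_norm_sq (hU : IsPropagator T b 𝔸 U) (h𝔸 : NearIso 𝔸 lo hi) (hlo : 0 < lo)
    (hb : MemLp (stLift b) ∞ (volume.restrict (Ioo 0 T ×ˢ univ)))
    (hbdiv : ∀ᵐ t ∂(volume.restrict (Ioo 0 T)), FunctionSpaces.Torus.IsWeaklyDivFree (b t))
    {s : ℝ} (hs : 0 ≤ s) (hsT : s < T) (y : Lp (EuclideanSpace ℝ d) 2 (volume : Measure (UnitAddTorus d)))
    (hy : FunctionSpaces.Torus.IsWeaklyDivFree (y : UnitAddTorus d → EuclideanSpace ℝ d)) :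
    ContinuousOn (fun t => ‖U s t y‖ ^ 2) (Ico s T) := by
  obtain ⟨w, Gr, -, hG2, -, hE⟩ := hU.exists_norm_sq_eq h𝔸 hlo hb hbdiv hs hsT y hy
  set D : ℝ → ℝ := fun τ => ∫ x, ∑ l, ∑ i, ∑ c, ∑ e, 𝔸 i c l e * (Gr τ c x) i * (Gr τ e x) l with hD
  have hDI : IntegrableOn D (Ioo 0 (T - s)) := integrableOn_dissipation₀ 𝔸 hG2
  have hprim : ContinuousOn (fun r => ∫ τ in Ioc 0 r, D τ) (Icc 0 (T - s)) :=
    intervalIntegral.continuousOn_primitive ((integrableOn_Icc_iff_integrableOn_Ioo (by simp) (by simp)).2 hDI)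
  have hR : ContinuousOn (fun t => ‖y‖ ^ 2 - 2 * ∫ τ in Ioc 0 (t - s), D τ) (Ico s T) := by
    have h1 : ContinuousOn (fun t => ∫ τ in Ioc 0 (t - s), D τ) (Ico s T) :=
      hprim.comp (continuous_id.sub continuous_const).continuousOn fun t ht =>
        ⟨by linarith [ht.1], by linarith [ht.2]⟩
    exact continuousOn_const.sub (continuousOn_const.mul h1)
  exact hR.congr fun t ht => hE t ht

variable {M G : ℝ}

/-- **Loss-rate monotonicity of the propagator, interior times.** For `IsPropagator T b 𝔹 U` with `NearIso 𝔹 lo hi`,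
`0 < lo`, a smooth carrier `SmoothCarrier b M G`, times `0 ≤ s < r ≤ t < T` and every `x ∈ L²`:
`‖U s r x‖² − ‖U r t (U s r x)‖² ≤ (|hi|/lo)·e^{2#dG(t−s)}·((t−r)/(r−s))·(‖x‖² − ‖U s r x‖²)`.
Proof: σ-projection of `x` (`apply_eq_apply_starProjection`); the Galerkin limit from the projected datum along `b(s+·)` at
tensor `𝔹ᵀ` is the weak solution with tensor `𝔹` (`IsGalerkinLimit.isWeakTensorPassiveVectorOn`) and is represented by `U`
(`repr`); `IsGalerkinLimit.ae_loss_later_le` gives the inequality for a.e. pair of times, and continuity of `t ↦ ‖U s t y‖²`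
on `[s,T)` upgrades it to the given times. [cite: Temam1984, Ch. III §2 (3.41)–(3.47)] [cite: ConstantinFoias1988, Ch. 10] -/
theorem IsPropagator.loss_later_le_of_lt {𝔹 : Visc4 d} (hU : IsPropagator T b 𝔹 U) (h𝔹 : NearIso 𝔹 lo hi)
    (hlo : 0 < lo) (hb : SmoothCarrier b M G) {s r t : ℝ} (hs : 0 ≤ s) (hsr : s < r) (hrt : r ≤ t) (htT : t < T)
    (x : Lp (EuclideanSpace ℝ d) 2 (volume : Measure (UnitAddTorus d))) :
    ‖U s r x‖ ^ 2 - ‖U r t (U s r x)‖ ^ 2 ≤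
      (|hi| / lo * Real.exp (2 * ((Fintype.card d : ℝ) * G) * (t - s))) * ((t - r) / (r - s)) *
        (‖x‖ ^ 2 - ‖U s r x‖ ^ 2) := by
  have hsT : s < T := (hsr.trans_le hrt).trans htT
  -- σ-projection of the datum
  set y := (divFreeL2 d).starProjection x with hydef
  have hy : FunctionSpaces.Torus.IsWeaklyDivFree (y : UnitAddTorus d → EuclideanSpace ℝ d) :=
    isWeaklyDivFree_starProjection x
  have hyx : ‖y‖ ≤ ‖x‖ := (divFreeL2 d).norm_starProjection_apply_le x
  have hUx : U s r x = U s r y := hU.apply_eq_apply_starProjection s r x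
  have hcomp : U r t (U s r y) = U s t y := hU.comp s r t hs hsr.le hrt htT.le y
  -- the carrier on `(0, T)`
  have hbT : MemLp (stLift b) ∞ (volume.restrict (Ioo 0 T ×ˢ univ)) := hb.memLp_top_stLift T
  have hbdiv : ∀ᵐ τ ∂(volume.restrict (Ioo 0 T)), FunctionSpaces.Torus.IsWeaklyDivFree (b τ) :=
    ae_of_all _ fun τ => hb.isWeaklyDivFree τ
  -- the energy `E(τ) = ‖U s (s+τ) y‖²` is continuous on `[0, T − s)`
  set E : ℝ → ℝ := fun τ => ‖U s (s + τ) y‖ ^ 2 with hEdef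
  have hEc : ContinuousOn E (Ico 0 (T - s)) :=
    (hU.continuousOn_norm_sq h𝔹 hlo hbT hbdiv hs hsT y hy).comp (continuous_const.add continuous_id).continuousOn
      fun τ hτ => ⟨by linarith [hτ.1], by linarith [hτ.2]⟩
  -- the Galerkin limit from `y` along `b (s + ·)` at tensor `𝔹ᵀ`, a weak solution at tensor `𝔹`, represented by `U`
  have hym : MemLp (y : UnitAddTorus d → EuclideanSpace ℝ d) 2 volume := Lp.memLp y
  have hP : PVSSetup (majorTranspose 𝔹) lo hi (fun τ => b (s + τ)) M G (y : UnitAddTorus d → EuclideanSpace ℝ d) :=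
    ⟨(nearIso_majorTranspose_iff 𝔹 lo hi).2 h𝔹, hlo.le, hb.comp_add s, hym, hy⟩
  obtain ⟨φ, c, w, hl⟩ := hP.exists_isGalerkinLimit
  have hsol : IsWeakTensorPassiveVectorOn 0 (T - s) 𝔹 (fun τ => b (s + τ))
      (y : UnitAddTorus d → EuclideanSpace ℝ d) w := by
    simpa only [majorTranspose_majorTranspose] using hl.isWeakTensorPassiveVectorOn (sub_pos.2 hsT)
  have hrep := hU.repr s hs hsT _ hym hy w hsol
  have hyLp : hym.toLp (y : UnitAddTorus d → EuclideanSpace ℝ d) = y := Lp.toLp_coeFn y hym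
  have hE0 : (∫ z, ‖(y : UnitAddTorus d → EuclideanSpace ℝ d) z‖ ^ 2) = ‖y‖ ^ 2 :=
    (norm_sq_eq_integral_norm_sq y).symm
  have hae1 : ∀ᵐ τ ∂(volume.restrict (Ioo 0 (T - s))), (∫ z, ‖w τ z‖ ^ 2) = E τ := by
    filter_upwards [hrep] with τ hτ
    obtain ⟨hm, he⟩ := hτ
    rw [hyLp] at he
    rw [hEdef]
    simp only
    rw [← he, norm_toLp_sq_eq_integral hm]
  -- the loss inequality for a.e. pair of times
  set Lf : ℝ → ℝ → ℝ := fun ρ' θ' =>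
    (|hi| / lo * Real.exp (2 * ((Fintype.card d : ℝ) * G) * θ')) * ((θ' - ρ') / ρ') with hLf
  have hae2 := hl.ae_loss_later_le hlo (sub_pos.2 hsT)
  have hae : ∀ᵐ ρ' ∂(volume.restrict (Ioo 0 (T - s))), ∀ᵐ θ' ∂(volume.restrict (Ioo 0 (T - s))),
      ρ' ≤ θ' → (E ρ' - E θ') + Lf ρ' θ' * E ρ' ≤ Lf ρ' θ' * ‖y‖ ^ 2 := by
    filter_upwards [hae1, hae2] with ρ' h1 h2
    filter_upwards [hae1, h2] with θ' h1' h2' hle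
    have := h2' hle
    rw [h1, h1', hE0] at this
    exact this
  -- the two times
  set ρ : ℝ := r - s with hρdef
  set θ : ℝ := t - s with hθdef
  have hρ0 : 0 < ρ := by rw [hρdef]; linarith
  have hρθ : ρ ≤ θ := by rw [hρdef, hθdef]; linarith
  have hθT : θ < T - s := by rw [hθdef]; linarith
  -- continuity of `Lf` in each variable
  have hLθ : ∀ ρ' : ℝ, Continuous fun θ' => Lf ρ' θ' := fun ρ' =>
    (continuous_const.mul (Real.continuous_exp.comp (continuous_const.mul continuous_id))).mul
      ((continuous_id.sub continuous_const).div_const ρ')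
  have hLρ : ∀ θ' a : ℝ, 0 < a → ContinuousOn (fun ρ' => Lf ρ' θ') (Ici a) := fun θ' a ha =>
    continuousOn_const.mul ((continuousOn_const.sub continuousOn_id).div continuousOn_id
      fun ρ' hρ' => ne_of_gt (lt_of_lt_of_le ha hρ'))
  -- pass 1: for a.e. `ρ'`, the inequality holds at `θ' = θ`
  have hP1 : ∀ᵐ ρ' ∂(volume.restrict (Ioo 0 (T - s))), ρ' < θ →
      (E ρ' - E θ) + Lf ρ' θ * E ρ' ≤ Lf ρ' θ * ‖y‖ ^ 2 := by
    filter_upwards [hae, ae_restrict_mem measurableSet_Ioo] with ρ' hρ' hρ'I hlt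
    have hsub : Ioo ρ' θ ⊆ Ioo 0 (T - s) := Ioo_subset_Ioo hρ'I.1.le hθT.le
    have hEc1 : ContinuousOn E (Icc ρ' θ) := hEc.mono fun τ hτ => ⟨hρ'I.1.le.trans hτ.1, lt_of_le_of_lt hτ.2 hθT⟩
    have hf : ContinuousOn (fun θ' => (E ρ' - E θ') + Lf ρ' θ' * E ρ') (Icc ρ' θ) :=
      (continuousOn_const.sub hEc1).add ((hLθ ρ').continuousOn.mul continuousOn_const)
    have hg : ContinuousOn (fun θ' => Lf ρ' θ' * ‖y‖ ^ 2) (Icc ρ' θ) := (hLθ ρ').continuousOn.mul continuousOn_const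
    have hfg : ∀ᵐ θ' ∂(volume.restrict (Ioo ρ' θ)), (E ρ' - E θ') + Lf ρ' θ' * E ρ' ≤ Lf ρ' θ' * ‖y‖ ^ 2 := by
      filter_upwards [ae_restrict_of_ae_restrict_of_subset hsub hρ', ae_restrict_mem measurableSet_Ioo] with θ' h1 h2
      exact h1 h2.1.le
    exact le_on_Icc_of_ae_le_of_continuousOn₂ hlt hf hg hfg θ ⟨hlt.le, le_rfl⟩
  -- pass 2: the inequality holds at `ρ' = ρ`
  have hP2 : (E ρ - E θ) + Lf ρ θ * E ρ ≤ Lf ρ θ * ‖y‖ ^ 2 := by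
    have hac : ρ / 2 < ρ := by linarith
    have hsub : Ioo (ρ / 2) ρ ⊆ Ioo 0 (T - s) := Ioo_subset_Ioo (by linarith) (hρθ.trans hθT.le)
    have hEc2 : ContinuousOn E (Icc (ρ / 2) ρ) :=
      hEc.mono fun τ hτ => ⟨le_trans (by linarith) hτ.1, lt_of_le_of_lt (hτ.2.trans hρθ) hθT⟩
    have hL2 : ContinuousOn (fun ρ' => Lf ρ' θ) (Icc (ρ / 2) ρ) :=
      (hLρ θ (ρ / 2) (by linarith)).mono Icc_subset_Ici_self
    have hf : ContinuousOn (fun ρ' => (E ρ' - E θ) + Lf ρ' θ * E ρ') (Icc (ρ / 2) ρ) :=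
      (hEc2.sub continuousOn_const).add (hL2.mul hEc2)
    have hg : ContinuousOn (fun ρ' => Lf ρ' θ * ‖y‖ ^ 2) (Icc (ρ / 2) ρ) := hL2.mul continuousOn_const
    have hfg : ∀ᵐ ρ' ∂(volume.restrict (Ioo (ρ / 2) ρ)), (E ρ' - E θ) + Lf ρ' θ * E ρ' ≤ Lf ρ' θ * ‖y‖ ^ 2 := by
      filter_upwards [ae_restrict_of_ae_restrict_of_subset hsub hP1, ae_restrict_mem measurableSet_Ioo] with ρ' h1 h2
      exact h1 (lt_of_lt_of_le h2.2 hρθ)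
    exact le_on_Icc_of_ae_le_of_continuousOn₂ hac hf hg hfg ρ ⟨hac.le, le_rfl⟩
  -- conclusion
  have hL0 : 0 ≤ Lf ρ θ := by
    simp only [hLf]
    have : 0 ≤ θ - ρ := sub_nonneg.2 hρθ
    positivity
  have hEρ : E ρ = ‖U s r y‖ ^ 2 := by
    simp only [hEdef, hρdef, add_sub_cancel]
  have hEθ : E θ = ‖U r t (U s r y)‖ ^ 2 := by
    simp only [hEdef, hθdef, add_sub_cancel, hcomp]
  have hLeq : Lf ρ θ = (|hi| / lo * Real.exp (2 * ((Fintype.card d : ℝ) * G) * (t - s))) * ((t - r) / (r - s)) := by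
    simp only [hLf, hρdef, hθdef]
    congr 2
    ring
  have hyx2 : ‖y‖ ^ 2 ≤ ‖x‖ ^ 2 := pow_le_pow_left₀ (norm_nonneg _) hyx 2
  rw [hUx, ← hLeq]
  rw [hEρ, hEθ] at hP2
  have := mul_le_mul_of_nonneg_left hyx2 hL0
  nlinarith [hP2, this, hL0]

/-- **LOSS-RATE MONOTONICITY OF THE PASSIVE-VECTOR PROPAGATOR** (all admissible times, endpoint included). For the
solution propagator `IsPropagator T b 𝔹 U` with `NearIso 𝔹 lo hi`, `0 < lo`, a smooth carrier `SmoothCarrier b M G`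
(jointly continuous, smooth divergence-free slices, `‖b‖ ≤ M`, `|∂_c b_a| ≤ G` at all times), times `0 ≤ s < r ≤ t ≤ T`
and every `x ∈ L²(T^d; ℝ^d)`:

  `‖U s r x‖² − ‖U r t (U s r x)‖² ≤ (|hi|/lo) · exp(2 · #d · G · (t − s)) · ((t − r)/(r − s)) · (‖x‖² − ‖U s r x‖²)`

— what prepared data lose on the later window `[r,t]` is at most `Cmono · (t−r)/(r−s)` of what they lost on `[s,r]`, with
`Cmono = (|hi|/lo)·e^{2#dG(t−s)}` (quasi-monotonicity of the dissipation rate `D(τ₂) ≤ Cmono·D(τ₁)`, `τ₁ ≤ τ₂`, from the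
enstrophy Gronwall inequality with constant `2#d·sup|∇b|` and the Legendre–Hadamard sandwich `lo‖∇u‖² ≤ D ≤ |hi|‖∇u‖²`,
proved on Fourier–Galerkin approximants and passed to the limit, `loss_later_le_of_lt`; the endpoint `t = T` through the
propagator on the horizon `T + 1`, which restricts to `U` by uniqueness).
[cite: Temam1984, Ch. III §2 (3.41)–(3.47)] [cite: ConstantinFoias1988, Ch. 10] [cite: Pazy1983, Ch. 5 §5.1 Thm. 5.3] -/
theorem IsPropagator.loss_later_le [Nonempty d] {𝔹 : Visc4 d} (hU : IsPropagator T b 𝔹 U) (h𝔹 : NearIso 𝔹 lo hi)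
    (hlo : 0 < lo) (hb : SmoothCarrier b M G) {s r t : ℝ} (hs : 0 ≤ s) (hsr : s < r) (hrt : r ≤ t) (htT : t ≤ T)
    (x : Lp (EuclideanSpace ℝ d) 2 (volume : Measure (UnitAddTorus d))) :
    ‖U s r x‖ ^ 2 - ‖U r t (U s r x)‖ ^ 2 ≤
      (|hi| / lo * Real.exp (2 * ((Fintype.card d : ℝ) * G) * (t - s))) * ((t - r) / (r - s)) *
        (‖x‖ ^ 2 - ‖U s r x‖ ^ 2) := by
  -- the propagator on the longer horizon `T + 1` restricts to `U`
  have hb₁ : MemLp (stLift b) ∞ (volume.restrict (Ioo 0 (T + 1) ×ˢ univ)) := hb.memLp_top_stLift (T + 1)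
  have hbdiv₁ : ∀ᵐ τ ∂(volume.restrict (Ioo 0 (T + 1))), FunctionSpaces.Torus.IsWeaklyDivFree (b τ) :=
    ae_of_all _ fun τ => hb.isWeaklyDivFree τ
  have hbT : MemLp (stLift b) ∞ (volume.restrict (Ioo 0 T ×ˢ univ)) := hb.memLp_top_stLift T
  have hbdivT : ∀ᵐ τ ∂(volume.restrict (Ioo 0 T)), FunctionSpaces.Torus.IsWeaklyDivFree (b τ) :=
    ae_of_all _ fun τ => hb.isWeaklyDivFree τ
  obtain ⟨U₁, hU₁⟩ := exists_isPropagator h𝔹 hlo hb₁ hbdiv₁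
  have hU₁T : IsPropagator T b 𝔹 U₁ := hU₁.of_horizon_le h𝔹 hlo hb₁ hbdiv₁ (by linarith)
  have heq : ∀ s' t', 0 ≤ s' → s' ≤ t' → t' ≤ T → ∀ z, U s' t' z = U₁ s' t' z := fun s' t' hs' hst' ht'T z =>
    hU.eq_of_isPropagator hU₁T h𝔹 hlo hbT hbdivT hs' hst' ht'T z
  rw [heq s r hs hsr.le (hrt.trans htT) x, heq r t (hs.trans hsr.le) hrt htT]
  exact hU₁.loss_later_le_of_lt h𝔹 hlo hb hs hsr hrt (by linarith) x

/-- **Window form of the loss-rate monotonicity** (the shape of the (N2) conjunct of `cellInputs_alphaBeta_text`: refresh length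
`R > 0`, window start `t₁ ≥ 0`, end time `s'` with `t₁ + R ≤ s' ≤ t₁ + 2R`, `s' ≤ T`; the exponential is bounded using `t − s ≤ 2R`
and `G ≥ 0`):
`‖U t₁ (t₁+R) x‖² − ‖U (t₁+R) s' (U t₁ (t₁+R) x)‖² ≤ (|hi|/lo)·e^{4·#d·G·R} · ((s' − (t₁+R))/R) · (‖x‖² − ‖U t₁ (t₁+R) x‖²)`.
[cite: Temam1984, Ch. III §2 (3.41)–(3.47)] [cite: ConstantinFoias1988, Ch. 10] -/
theorem IsPropagator.loss_window_le [Nonempty d] {𝔹 : Visc4 d} (hU : IsPropagator T b 𝔹 U) (h𝔹 : NearIso 𝔹 lo hi)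
    (hlo : 0 < lo) (hb : SmoothCarrier b M G) {t₁ R s' : ℝ} (ht₁ : 0 ≤ t₁) (hR : 0 < R) (h₁ : t₁ + R ≤ s')
    (h₂ : s' ≤ t₁ + 2 * R) (hs'T : s' ≤ T) (x : Lp (EuclideanSpace ℝ d) 2 (volume : Measure (UnitAddTorus d))) :
    ‖U t₁ (t₁ + R) x‖ ^ 2 - ‖U (t₁ + R) s' (U t₁ (t₁ + R) x)‖ ^ 2 ≤
      (|hi| / lo * Real.exp (4 * ((Fintype.card d : ℝ) * G) * R)) * ((s' - (t₁ + R)) / R) *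
        (‖x‖ ^ 2 - ‖U t₁ (t₁ + R) x‖ ^ 2) := by
  have h := hU.loss_later_le h𝔹 hlo hb ht₁ (by linarith : t₁ < t₁ + R) h₁ hs'T x
  rw [show t₁ + R - t₁ = R by ring] at h
  refine h.trans ?_
  have hcG : 0 ≤ 2 * ((Fintype.card d : ℝ) * G) := by have := hb.grad_nonneg; positivity
  have hexp : Real.exp (2 * ((Fintype.card d : ℝ) * G) * (s' - t₁)) ≤ Real.exp (4 * ((Fintype.card d : ℝ) * G) * R) := by
    refine Real.exp_le_exp.2 ?_
    have h3 := mul_le_mul_of_nonneg_left (by linarith : s' - t₁ ≤ 2 * R) hcG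
    linarith
  have hA : 0 ≤ |hi| / lo := div_nonneg (abs_nonneg _) hlo.le
  have hfrac : 0 ≤ (s' - (t₁ + R)) / R := div_nonneg (by linarith) hR.le
  have hloss : 0 ≤ ‖x‖ ^ 2 - ‖U t₁ (t₁ + R) x‖ ^ 2 := by
    have h4 := hU.norm_le t₁ (t₁ + R) x
    nlinarith [norm_nonneg (U t₁ (t₁ + R) x), norm_nonneg x]
  exact mul_le_mul_of_nonneg_right (mul_le_mul_of_nonneg_right (mul_le_mul_of_nonneg_left hexp hA) hfrac) hloss

end Propagator

end Torus

end Literature.Analysis.FluidPDE
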